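import Summits.PneNP.PneNP.Theorems.ConvexRankGatesLinAlgGateBlindPlanting

/-!
# Route ConvexRankGates, crux `LinAlgGateBlind` (stmt-PneNP-10681): the facet cover (SG from a facet count)

Support theorem for the crux (vocabulary of `Theorems/ConvexRankGatesLinAlgGateBlindDefs.lean`). Every single-gate
statement `SGAt` landed for this crux (PERM by subgroup chains, span programs, group order, GRANK by live spans,
Kőnig/Hall covers, matroid rank, Tutte, matroid intersection) is a union bound over a MAXTERM COVER of the rejection
region of a term gate, fed to the planting theorem `sg_of_maxtermCover`. This file isolates the one mechanism behind
all of them, for an ARBITRARY monotone gate class `P`: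

* the rejecting atom families `A ⊆ 𝒱(l)` of a term gate `g(⌈X_a⌉)_a` (those with `g(𝟙[X_a ∈ A]) = 0`) form a
  down-set (monotonicity), whose maximal members — the FACETS — give a maxterm cover: a graph is rejected iff for some
  facet `A` every atom outside `A` is absent (`⇒`: the live family is rejecting, hence inside a facet; `⇐`: the live
  family lies inside `A` and `g` is monotone);
* `sgAt_of_facet_budget`: hence `SGAt m P l k q ε` holds as soon as every term gate of the class has at most `N` facets
  and `N · (1/2)^{ν+1} · #𝒱(l) < ε` (with the usual positive budget `(ν·C(l,2))^t·C(m-t,k-t) ≤ ε·C(m,k)`).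

So the single-gate statement for a gate class is EXACTLY a facet count, and the union-bound method reaches a class at
gate parameter `m^γ` iff `log₂ #facets = o(m^{7/8})` there. For `GRANK_s` the live-span cover of
`…GRankChainCover` is the bound `#facets ≤ #𝒱(l)^{s²}`; the conjectured bound `Σ_{j ≤ 2s-2} C(n, j)` for the number of
maximal singular coordinate sub-pencils of `n` matrices in `M_s(F)` (attained up to the factor 2 in the exponent by
rank-one pencils, and with pinning number exactly `2(s-1)` by the Kőnig pencil) would, through this theorem, move the
general `GRANK` door from `γ < 7/16` to the union-bound limit `γ < 7/8`. Sources: Razborov 1985, Alon–Boppana 1987 §3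
(approximation method); the planting theorem is the tree's. No new definitions. [folklore]
-/

-- `Summit.PneNP.PneNP.…` duplicates `PneNP` BY DESIGN (single-problem summit).
set_option linter.dupNamespace false

namespace Summit.PneNP.PneNP.Theorems

open Finset Filter Literature.Computability.Complexity Razborov
open Summit.PneNP.PneNP.Cruxes.LinAlgGateBlind.DnfInvariantWideGatesSeeSmallCliques

/-- **SG from a facet count (the facet cover).** Let `P` be a class of MONOTONE gates, and suppose every term gate of
the class over `≤ l`-atoms has at most `N` facets — maximal atom families `A ⊆ 𝒱(l)` with `g(𝟙[X_a ∈ A]) = 0` — in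
the form: every finite set of such facets has at most `N` members. If `q ∈ [0,1]`, `1 - q^{C(l,2)} ≤ 1/2`, `0 < ε`,
`2t ≤ l`, `(ν·C(l,2))^t · C(m-t,k-t) ≤ ε·C(m,k)` and `N · (1/2)^{ν+1} · #𝒱(l) < ε`, then `SGAt m P l k q ε`.
Proof: the facets give a maxterm cover of the rejection region of size `≤ N` (a rejected graph's live family is
rejecting, hence inside a facet `A`, i.e. every atom outside `A` is absent; conversely if every atom outside a facet
`A` is absent the live family is inside `A` and the monotone gate rejects), and `sg_of_maxtermCover` with
`η = ε/#𝒱(l)` concludes. [folklore] -/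
theorem sgAt_of_facet_budget : ∀ (m l k N ν t : ℕ) (q ε : ℝ) (P : GateFn → Prop),
    (∀ g, P g → Monotone g.2) →
    (∀ g, P g → ∀ X : Fin g.1 → Finset (Fin m), (∀ a, X a ∈ smallSets (Fin m) l) →
      ∀ 𝓕 : Finset (Finset (Finset (Fin m))),
        (∀ A ∈ 𝓕, A ⊆ smallSets (Fin m) l ∧ g.2 (fun a => decide (X a ∈ A)) = false ∧
          ∀ Y ∈ smallSets (Fin m) l, Y ∉ A → g.2 (fun a => decide (X a ∈ insert Y A)) = true) →
        #𝓕 ≤ N) →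
    0 ≤ q → q ≤ 1 → 1 - q ^ (l.choose 2) ≤ 1 / 2 → 0 < ε → 2 * t ≤ l →
    (((ν * l.choose 2) ^ t * (m - t).choose (k - t) : ℕ) : ℝ) ≤ ε * (m.choose k : ℝ) →
    (N : ℝ) * (1 / 2) ^ (ν + 1) * #(smallSets (Fin m) l) < ε →
    SGAt m P l k q ε := by
  intro m l k N ν t q ε P hmonoP hN hq0 hq1 hql hε htl hpos hfrag O hO
  classical
  obtain ⟨g, hg, X, hX, hOX⟩ := hO
  have hmono : Monotone g.2 := hmonoP g hg
  set V := smallSets (Fin m) l with hVdef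
  have hV : (0 : ℝ) < #V := Nat.cast_pos.2 (card_pos.2 ⟨∅, empty_mem_smallSets l⟩)
  -- the indicator input vector of an atom family, the rejecting families and their facets
  set ind : Finset (Finset (Fin m)) → Fin g.1 → Bool := fun A a => decide (X a ∈ A) with hind
  set S : Finset (Finset (Finset (Fin m))) := V.powerset.filter fun A => g.2 (ind A) = false with hSdef
  set 𝓕 : Finset (Finset (Finset (Fin m))) := S.filter fun A => Maximal (· ∈ S) A with h𝓕def
  have hS : ∀ A, A ∈ S ↔ A ⊆ V ∧ g.2 (ind A) = false := fun A => by
    rw [hSdef, mem_filter, mem_powerset]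
  have h𝓕 : ∀ A ∈ 𝓕, A ⊆ V ∧ g.2 (ind A) = false ∧ ∀ Y ∈ V, Y ∉ A → g.2 (ind (insert Y A)) = true := by
    intro A hA
    obtain ⟨hAS, hmax⟩ := mem_filter.1 hA
    obtain ⟨hAV, hArej⟩ := (hS A).1 hAS
    refine ⟨hAV, hArej, fun Y hY hYA => ?_⟩
    -- `insert Y A` is a strictly larger family inside `V`, hence not rejecting
    cases hval : g.2 (ind (insert Y A))
    · have hins : insert Y A ∈ S := (hS _).2 ⟨insert_subset hY hAV, hval⟩
      exact absurd ((hmax.2 hins (subset_insert Y A)) (mem_insert_self Y A)) hYA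
    · rfl
  have hcard : #𝓕 ≤ N := hN g hg X hX 𝓕 h𝓕
  -- the live family of a graph and its indicator
  set lv : (KEdge m → Bool) → Finset (Finset (Fin m)) := fun x => V.filter fun Y => CliquePresent Y x with hlv
  have hlv_ind : ∀ x, ind (lv x) = fun a => atomB (X a) x := by
    intro x
    funext a
    rw [hind, hlv]
    simp only [mem_filter, hX a, true_and, atomB]
  -- index the facet cover
  set N' := #𝓕 with hN'def
  set e := 𝓕.equivFin with he
  set 𝓛 : Fin N' → Finset (Finset (Fin m)) := fun j => V \ (e.symm j).1 with h𝓛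
  have hNlt : (N' : ℝ) * (1 / 2) ^ (ν + 1) < ε / #V := by
    rw [lt_div_iff₀ hV]
    have hc : (N' : ℝ) ≤ N := by exact_mod_cast hcard
    calc (N' : ℝ) * (1 / 2) ^ (ν + 1) * #V ≤ (N : ℝ) * (1 / 2) ^ (ν + 1) * #V := by gcongr
      _ < ε := hfrag
  have h1 : ∀ j, 𝓛 j ⊆ V := fun j => sdiff_subset
  have h2 : ∀ x, O x = false → ∃ j, ∀ Y ∈ 𝓛 j, ¬ CliquePresent Y x := by
    intro x hx
    have hlvS : lv x ∈ S := by
      refine (hS _).2 ⟨filter_subset _ _, ?_⟩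
      rw [hlv_ind, ← hOX x]
      exact hx
    obtain ⟨A, hlvA, hmax⟩ := S.exists_le_maximal hlvS
    have hA𝓕 : A ∈ 𝓕 := mem_filter.2 ⟨hmax.1, hmax⟩
    refine ⟨e ⟨A, hA𝓕⟩, fun Y hY hYx => ?_⟩
    have hY' : Y ∈ V \ A := by simpa [h𝓛] using hY
    exact (mem_sdiff.1 hY').2 (hlvA (mem_filter.2 ⟨(mem_sdiff.1 hY').1, hYx⟩))
  have h3 : ∀ j x, (∀ Y ∈ 𝓛 j, ¬ CliquePresent Y x) → O x = false := by
    intro j x hall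
    obtain ⟨hAV, hArej, -⟩ := h𝓕 (e.symm j).1 (e.symm j).2
    have hle : (fun a => atomB (X a) x) ≤ ind (e.symm j).1 := by
      intro a ha
      have hlive : CliquePresent (X a) x := by simpa [atomB] using ha
      rw [hind]
      simp only [decide_eq_true_eq]
      by_contra hXa
      exact hall (X a) (mem_sdiff.2 ⟨hX a, hXa⟩) hlive
    have h := hmono hle
    rw [hArej] at h
    rw [hOX x]
    cases hval : g.2 (fun a => atomB (X a) x)
    · rfl
    · rw [hval] at h
      exact absurd h (by decide)
  obtain ⟨𝒜, h𝒜, hP, hNg⟩ := sg_of_maxtermCover m l k N' ν t q (ε / #V) O 𝓛 h1 h2 h3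
    hq0 hq1 hql (div_pos hε hV) hNlt htl
  refine ⟨𝒜, h𝒜, ?_, hNg.trans_eq (mul_div_cancel₀ ε hV.ne')⟩
  calc (#(lostPos m k O 𝒜) : ℝ) ≤ (((ν * l.choose 2) ^ t * (m - t).choose (k - t) : ℕ) : ℝ) := by
        exact_mod_cast hP
    _ ≤ ε * (m.choose k : ℝ) := hpos

end Summit.PneNP.PneNP.Theorems
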